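import Mathlib.LinearAlgebra.Matrix.Block
import Mathlib.LinearAlgebra.Matrix.Rank
import Mathlib.LinearAlgebra.Dimension.OrzechProperty
import Literature.Computability.AlgebraicComplexity.BI17FundamentalInvariantForms
import Literature.RepresentationTheory.ClassicalInvariants.LinearSubstitution
import HarnessLib

/-!
# Eigenbasis charts for stabilizers of forms

Linear algebra behind the dimension count of Matsumura–Monsky 1964 (quoted in Bürgisser–Ikenmeyer
2017 §2.1 as "almost all `w ∈ Sym^D ℂ^m` have a trivial stabilizer", the tree's fact
`BI2017_matsumuraMonsky_trivialStabilizer`, and in Poonen 2005 Thm. 3): if a finite-order linear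
substitution `γ` stabilises a form `w`, then after a change of coordinates `P` diagonalising `γ`
(tree: `exists_mul_eq_mul_diagonal_of_pow_eq_one`) the form `v = P⁻¹ · w` is invariant under
`diag(c)` and hence supported on the monomials `x^e` with `c^e = 1` (`invMonomials`); writing
`P = g · l` with `l` block-diagonal for the eigenvalue partition (so `l` commutes with `diag(c)`)
and `g` normalised to carry an identity pattern on pivot rows in each group of columns
(`exists_pivot_decomposition`), the form `w = g · (l · v)` lies in the image of an affine chart with
`#{(i,j) : c_i ≠ c_j}` matrix parameters (`chartMatrix`, `card_chartVars`) applied to forms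
supported on `invMonomials D c`. The packaged statement is `exists_eigenChart_of_pow_eq_one`.

Consumer: `GenericTrivialStabilizerProofs.lean` (with `FormChartDimensionCount.lean`). No new facts;
the definitions are plumbing with bodies. Honest framing: classical linear algebra; nothing here
bears on VP versus VNP. [cite: BurgisserIkenmeyer2017, §2.1 ("almost all w ∈ Sym^D ℂ^m")]

## References

* P. Bürgisser, C. Ikenmeyer, *Fundamental invariants of orbit closures*, J. Algebra 477 (2017),
  §2.1. [BurgisserIkenmeyer2017]
* H. Matsumura, P. Monsky, *On the automorphisms of hypersurfaces*, J. Math. Kyoto Univ. 3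
  (1963/64) 347–361. [MatsumuraMonsky1963]

## Tree

`linSubst`, `linSubst_mul`, `linSubst_one`, `linSubst_isHomogeneous` (`LinSubst`);
`linSubst_diagonal_monomial` (`OrbitClosureWeights`); `degMonomials`, `mem_degMonomials_iff`
(`OrbitCoordinateRing`); `exists_mul_eq_mul_diagonal_of_pow_eq_one`
(`Literature.RepresentationTheory.ClassicalInvariants.LinearSubstitution`).
-/

noncomputable section

open MvPolynomial Matrix

namespace Literature.Computability.AlgebraicComplexity

/-! ### Diagonal substitutions act on monomials by characters -/

section DiagonalAction

variable {σ : Type*} [Fintype σ] [DecidableEq σ] {K : Type*} [Field K]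

/-- Coefficients under a diagonal substitution: `coeff d (diag(c) · v) = c^d · coeff d v`
(local copy of the tree's `coeff_linSubst_diagonal`). [folklore] -/
private theorem coeff_linSubst_diagonal_eq_prod_mul (c : σ → K) (v : MvPolynomial σ K)
    (d : σ →₀ ℕ) :
    coeff d (linSubst σ K (diagonal c) v) = (d.prod fun i k => c i ^ k) * coeff d v := by
  induction v using MvPolynomial.induction_on' with
  | monomial e a =>
    rw [linSubst_diagonal_monomial, coeff_smul, coeff_monomial, smul_eq_mul]
    split_ifs with h
    · subst h; rfl
    · rw [mul_zero, mul_zero]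
  | add p q hp hq => rw [map_add, coeff_add, coeff_add, hp, hq, mul_add]

/-- **A `diag(c)`-invariant form is supported on the monomials with `c^e = 1`.**
[cite: BurgisserIkenmeyer2017, §2.1 ("almost all w")] -/
theorem prod_pow_eq_one_of_linSubst_diagonal_eq {c : σ → K} {v : MvPolynomial σ K}
    (h : linSubst σ K (diagonal c) v = v) {d : σ →₀ ℕ} (hd : d ∈ v.support) :
    (d.prod fun i k => c i ^ k) = 1 := by
  have h1 := congrArg (coeff d) h
  rw [coeff_linSubst_diagonal_eq_prod_mul] at h1
  exact mul_right_cancel₀ (mem_support_iff.mp hd) (by rw [h1, one_mul])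

open scoped Classical in
/-- The degree-`D` monomials invariant under `diag(c)`: `{e : |e| = D, c^e = 1}`.
[cite: BurgisserIkenmeyer2017, §2.1 ("almost all w")] -/
def invMonomials (D : ℕ) (c : σ → K) : Finset (σ →₀ ℕ) :=
  (degMonomials σ D).filter fun e => (e.prod fun i k => c i ^ k) = 1

/-- Membership in `invMonomials`. [cite: BurgisserIkenmeyer2017, §2.1 ("almost all w")] -/
theorem mem_invMonomials_iff {D : ℕ} {c : σ → K} {e : σ →₀ ℕ} :
    e ∈ invMonomials D c ↔ e.degree = D ∧ (e.prod fun i k => c i ^ k) = 1 := by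
  classical
  rw [invMonomials, Finset.mem_filter, mem_degMonomials_iff]

/-- `invMonomials D c` consists of degree-`D` monomials. [cite: BurgisserIkenmeyer2017, §2.1 ("almost all w")] -/
theorem invMonomials_subset (D : ℕ) (c : σ → K) : invMonomials D c ⊆ degMonomials σ D :=
  fun _ he => mem_degMonomials_iff.mpr (mem_invMonomials_iff.mp he).1

/-- A `diag(c)`-invariant form of degree `D` is supported on `invMonomials D c`.
[cite: BurgisserIkenmeyer2017, §2.1 ("almost all w")] -/
theorem support_subset_invMonomials {D : ℕ} {c : σ → K} {v : MvPolynomial σ K}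
    (hv : v.IsHomogeneous D) (h : linSubst σ K (diagonal c) v = v) :
    v.support ⊆ invMonomials D c := fun e he =>
  mem_invMonomials_iff.mpr ⟨by rw [Finsupp.degree_eq_weight_one]; exact hv (mem_support_iff.mp he),
    prod_pow_eq_one_of_linSubst_diagonal_eq h he⟩

/-- A matrix whose `(i,j)` entries vanish whenever `c_i ≠ c_j` commutes with `diag(c)`.
[cite: BurgisserIkenmeyer2017, §2.1 ("almost all w")] -/
theorem mul_diagonal_eq_diagonal_mul_of_apply_eq_zero {c : σ → K} {l : Matrix σ σ K}
    (hl : ∀ i j, c i ≠ c j → l i j = 0) : l * diagonal c = diagonal c * l := by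
  ext i j
  rw [mul_diagonal, diagonal_mul]
  by_cases h : c i = c j
  · rw [h, mul_comm]
  · rw [hl i j h, zero_mul, mul_zero]

/-- If `l` commutes with `diag(c)` then `l ·` preserves `diag(c)`-invariance.
[cite: BurgisserIkenmeyer2017, §2.1 ("almost all w")] -/
theorem linSubst_diagonal_linSubst_eq {c : σ → K} {l : Matrix σ σ K}
    (hl : l * diagonal c = diagonal c * l) {v : MvPolynomial σ K}
    (h : linSubst σ K (diagonal c) v = v) :
    linSubst σ K (diagonal c) (linSubst σ K l v) = linSubst σ K l v := by
  rw [← AlgHom.comp_apply, ← linSubst_mul, ← hl, linSubst_mul, AlgHom.comp_apply, h]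

end DiagonalAction

/-! ### Block labels of a tuple of eigenvalues -/

section Blocks

variable {m : ℕ} {K : Type*}

open scoped Classical in
/-- The block label of the index `i` for the tuple `c`: the least index `j` with `c_j = c_i`
(a combinatorial name for the eigenvalue class of `i`). [folklore] -/
def blkOf (c : Fin m → K) (i : Fin m) : Fin m :=
  (Finset.univ.filter fun j => c j = c i).min' ⟨i, by simp⟩

/-- `blkOf c i` lies in the class of `i`. [cite: BurgisserIkenmeyer2017, §2.1 ("almost all w")] -/
theorem apply_blkOf (c : Fin m → K) (i : Fin m) : c (blkOf c i) = c i := by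
  classical
  have h := Finset.min'_mem (Finset.univ.filter fun j => c j = c i) ⟨i, by simp⟩
  simp only [Finset.mem_filter, Finset.mem_univ, true_and] at h
  convert h using 2
  unfold blkOf
  congr

/-- The block label of `i` is at most any index carrying the value `c_i`. [folklore] -/
private theorem blkOf_le_of_apply_eq (c : Fin m → K) {i j : Fin m} (h : c j = c i) :
    blkOf c i ≤ j := by
  classical
  unfold blkOf
  convert Finset.min'_le (Finset.univ.filter fun j => c j = c i) j (by simp [h]) using 2

/-- Two indices have the same block label iff they carry the same value.
[cite: BurgisserIkenmeyer2017, §2.1 ("almost all w")] -/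
theorem blkOf_eq_blkOf_iff (c : Fin m → K) (i j : Fin m) : blkOf c i = blkOf c j ↔ c i = c j := by
  refine ⟨fun h => ?_, fun h => le_antisymm ?_ ?_⟩
  · rw [← apply_blkOf c i, h, apply_blkOf c j]
  · exact blkOf_le_of_apply_eq c (i := i) (j := blkOf c j) (by rw [apply_blkOf c j]; exact h.symm)
  · exact blkOf_le_of_apply_eq c (i := j) (j := blkOf c i) (by rw [apply_blkOf c i]; exact h)

end Blocks

/-! ### Pivot charts -/

section Charts

variable {m : ℕ} {K : Type*} [Field K]

/-- The parameters of the pivot chart `(blk, ρ)`: matrix positions `(i, j)` such that row `i` is not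
a pivot row `ρ j'` of any column `j'` in the block of `j`.
[cite: BurgisserIkenmeyer2017, §2.1 ("almost all w")] -/
def chartVars (blk ρ : Fin m → Fin m) : Type :=
  {q : Fin m × Fin m // ¬ ∃ j', blk j' = blk q.2 ∧ ρ j' = q.1}

/-- `chartVars` is a finite type. [folklore] -/
instance chartVars.instFintype (blk ρ : Fin m → Fin m) : Fintype (chartVars blk ρ) := by
  unfold chartVars; infer_instance

variable (K) in
/-- The matrix of the pivot chart `(blk, ρ)`: in column `j`, the pivot rows of `j`'s block carry the
identity pattern (`1` at `ρ j`, `0` at the other pivot rows of the block), all other entries are free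
parameters. [cite: BurgisserIkenmeyer2017, §2.1 ("almost all w")] -/
def chartMatrix (blk ρ : Fin m → Fin m) :
    Matrix (Fin m) (Fin m) (MvPolynomial (chartVars blk ρ) K) := fun i j =>
  if h : ∃ j', blk j' = blk j ∧ ρ j' = i then (if ρ j = i then 1 else 0) else X ⟨(i, j), h⟩

/-- A matrix with the pivot pattern of the chart `(blk, ρ)` (`ρ` injective on blocks) is the
specialisation of the chart matrix at its own free entries.
[cite: BurgisserIkenmeyer2017, §2.1 ("almost all w")] -/
theorem chartMatrix_map_eval {blk ρ : Fin m → Fin m}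
    (hρ : ∀ j j', blk j = blk j' → ρ j = ρ j' → j = j') {g : Matrix (Fin m) (Fin m) K}
    (hg : ∀ j j', blk j' = blk j → g (ρ j') j = if j' = j then 1 else 0) :
    (chartMatrix K blk ρ).map (MvPolynomial.eval fun q : chartVars blk ρ => g q.1.1 q.1.2) = g := by
  ext i j
  simp only [Matrix.map_apply, chartMatrix]
  split_ifs with h h'
  · obtain ⟨j', hj', rfl⟩ := h
    rw [map_one, hg j j' hj', if_pos (hρ j' j hj' h'.symm)]
  · obtain ⟨j', hj', rfl⟩ := h
    rw [map_zero, hg j j' hj', if_neg]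
    rintro rfl
    exact h' rfl
  · rw [eval_X]

/-- The number of free parameters of the pivot chart `(blk, ρ)` (`ρ` injective on blocks) is the
number of ordered pairs of indices in different blocks.
[cite: BurgisserIkenmeyer2017, §2.1 ("almost all w")] -/
theorem card_chartVars {blk ρ : Fin m → Fin m}
    (hρ : ∀ j j', blk j = blk j' → ρ j = ρ j' → j = j') :
    Fintype.card (chartVars blk ρ) =
      (Finset.univ.filter fun q : Fin m × Fin m => blk q.1 ≠ blk q.2).card := by
  classical
  -- count column by column
  have key : ∀ j : Fin m,
      (Finset.univ.filter fun i : Fin m => ¬ ∃ j', blk j' = blk j ∧ ρ j' = i).card =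
        (Finset.univ.filter fun i : Fin m => ¬ blk i = blk j).card := by
    intro j
    have h1 : (Finset.univ.filter fun i : Fin m => ∃ j', blk j' = blk j ∧ ρ j' = i) =
        (Finset.univ.filter fun j' : Fin m => blk j' = blk j).image ρ := by
      ext i
      simp only [Finset.mem_filter, Finset.mem_univ, true_and, Finset.mem_image]
    have h2 : ((Finset.univ.filter fun j' : Fin m => blk j' = blk j).image ρ).card =
        (Finset.univ.filter fun j' : Fin m => blk j' = blk j).card :=
      Finset.card_image_of_injOn fun a ha b hb hab => hρ a b
        (by rw [Finset.mem_coe, Finset.mem_filter] at ha hb; exact ha.2.trans hb.2.symm) hab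
    have h3 := Finset.card_filter_add_card_filter_not
      (s := (Finset.univ : Finset (Fin m))) (fun i : Fin m => ∃ j', blk j' = blk j ∧ ρ j' = i)
    have h4 := Finset.card_filter_add_card_filter_not
      (s := (Finset.univ : Finset (Fin m))) (fun i : Fin m => blk i = blk j)
    rw [h1, h2] at h3
    omega
  unfold chartVars
  rw [Fintype.card_subtype]
  simp only [Finset.card_filter, ← Finset.univ_product_univ, Finset.sum_product_right]
  refine Finset.sum_congr rfl fun j _ => ?_
  have hk := key j
  simp only [Finset.card_filter] at hk
  exact hk

end Charts

/-! ### The pivot decomposition `P = g · l` -/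

section Pivot

variable {m : ℕ} {K : Type*} [Field K]

/-- From a matrix with linearly independent columns one can select as many rows as columns so that
the square submatrix is invertible (column rank = row rank). [folklore] -/
private theorem exists_injective_isUnit_submatrix {n : Type} [Fintype n] [DecidableEq n]
    (A : Matrix (Fin m) n K) (hA : LinearIndependent K A.col) :
    ∃ r : n → Fin m, Function.Injective r ∧ IsUnit (Matrix.of fun a b : n => A (r a) b) := by
  classical
  -- the rows of `A` span `K^n`
  have hspan : Submodule.span K (Set.range A.row) = ⊤ := by
    apply Submodule.eq_top_of_finrank_eq
    rw [← rank_eq_finrank_span_row, rank_eq_finrank_span_cols, finrank_span_eq_card hA,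
      Module.finrank_fintype_fun_eq_card]
  obtain ⟨κ, a, ha, hsp, hli⟩ := exists_linearIndependent' K A.row
  rw [hspan] at hsp
  haveI : Finite κ := Finite.of_injective a ha
  letI : Fintype κ := Fintype.ofFinite κ
  have hcard : Fintype.card κ = Fintype.card n := by
    rw [linearIndependent_iff_card_eq_finrank_span.mp hli, Set.finrank, hsp, finrank_top,
      Module.finrank_fintype_fun_eq_card]
  let e : n ≃ κ := Fintype.equivOfCardEq hcard.symm
  refine ⟨a ∘ e, ha.comp e.injective, ?_⟩
  rw [← linearIndependent_rows_iff_isUnit]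
  exact hli.comp e e.injective

/-- **Pivot decomposition.** For an invertible matrix `P` and a block labelling `blk` of the indices,
`P = g · l` with `l` block-diagonal (`l i j = 0` unless `blk i = blk j`) and invertible, and `g`
normalised on pivot rows: there is a choice of pivot rows `ρ`, injective on each block, with
`g (ρ j') j = δ_{j' j}` whenever `j'` and `j` lie in the same block. (Each group of columns of `P`
is linearly independent, so some square minor on it is invertible; take `l` to be these minors and
`g = P · l⁻¹`.) [cite: BurgisserIkenmeyer2017, §2.1 ("almost all w")] -/
theorem exists_pivot_decomposition (blk : Fin m → Fin m) (P : Matrix (Fin m) (Fin m) K)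
    (hP : IsUnit P.det) :
    ∃ ρ : Fin m → Fin m, (∀ j j', blk j = blk j' → ρ j = ρ j' → j = j') ∧
      ∃ l g : Matrix (Fin m) (Fin m) K, (∀ i j, blk i ≠ blk j → l i j = 0) ∧ IsUnit l.det ∧
        (∀ j j', blk j' = blk j → g (ρ j') j = if j' = j then 1 else 0) ∧ P = g * l := by
  classical
  -- columns of `P` are linearly independent, hence so is each block of columns
  have hcols : LinearIndependent K P.col := linearIndependent_cols_of_det_ne_zero hP.ne_zero
  -- pivot rows for each block
  have hblock : ∀ k : Fin m, ∃ r : {j // blk j = k} → Fin m, Function.Injective r ∧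
      IsUnit (Matrix.of fun a b : {j // blk j = k} => P (r a) b) := fun k =>
    exists_injective_isUnit_submatrix (Matrix.of fun i (b : {j // blk j = k}) => P i b)
      (hcols.comp Subtype.val Subtype.val_injective)
  choose r hrinj hrunit using hblock
  let ρ : Fin m → Fin m := fun j => r (blk j) ⟨j, rfl⟩
  have hρr : ∀ (j : Fin m) (k : Fin m) (hk : blk j = k), ρ j = r k ⟨j, hk⟩ := by
    rintro j k rfl; rfl
  have hρ : ∀ j j', blk j = blk j' → ρ j = ρ j' → j = j' := by
    intro j j' hjj' h
    rw [hρr j (blk j) rfl, hρr j' (blk j) hjj'.symm] at h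
    exact congrArg Subtype.val (hrinj (blk j) h)
  -- the block-diagonal factor: the chosen square minors on the diagonal
  let l : Matrix (Fin m) (Fin m) K := Matrix.of fun i j => if blk i = blk j then P (ρ i) j else 0
  have hl : ∀ i j, l i j = if blk i = blk j then P (ρ i) j else 0 := fun i j => rfl
  have hl0 : ∀ i j, blk i ≠ blk j → l i j = 0 := fun i j h => by rw [hl, if_neg h]
  have hltri : l.BlockTriangular blk := fun i j hij => by rw [hl, if_neg (ne_of_gt hij)]
  have hlblock : ∀ k : Fin m, l.toSquareBlock blk k =
      Matrix.of fun a b : {j // blk j = k} => P (r k a) b := by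
    intro k
    ext ⟨a, ha⟩ ⟨b, hb⟩
    rw [toSquareBlock_def, Matrix.of_apply, Matrix.of_apply, hl, if_pos (ha.trans hb.symm),
      hρr a k ha]
  have hlunit : IsUnit l.det := by
    rw [isUnit_iff_ne_zero, hltri.det, Finset.prod_ne_zero_iff]
    intro k _
    rw [hlblock k]
    exact ((Matrix.isUnit_iff_isUnit_det _).mp (hrunit k)).ne_zero
  -- the normalised factor
  let g : Matrix (Fin m) (Fin m) K := P * l⁻¹
  have hgl : g * l = P := by
    change P * l⁻¹ * l = P
    rw [Matrix.mul_assoc, Matrix.nonsing_inv_mul l hlunit, Matrix.mul_one]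
  refine ⟨ρ, hρ, l, g, hl0, hlunit, ?_, hgl.symm⟩
  -- the pivot pattern of `g`: row `ρ j'` of `g`, restricted to the block of `j'`, times the minor
  -- equals row `j'` of the minor
  intro j j' hjj'
  set k : Fin m := blk j with hk
  let M : Matrix {x // blk x = k} {x // blk x = k} K := Matrix.of fun a b => P (r k a) b
  have hM : IsUnit M := hrunit k
  let u : {x // blk x = k} → K := fun x => g (ρ j') x
  have hu : u ᵥ* M = Pi.single (⟨j', hjj'⟩ : {x // blk x = k}) (1 : K) ᵥ* M := by
    funext b
    rw [single_one_vecMul]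
    change (∑ x : {x // blk x = k}, g (ρ j') x * P (r k x) b) = P (r k ⟨j', hjj'⟩) b
    -- `(g * l) (ρ j') b = P (ρ j') b`, and the sum defining the left side lives on the block `k`
    have h1 := (congrFun (congrFun hgl (ρ j')) b).symm
    rw [Matrix.mul_apply] at h1
    have h2 : ∀ x : Fin m, g (ρ j') x * l x b =
        if blk x = k then g (ρ j') x * P (ρ x) b else 0 := by
      intro x
      rw [hl, b.2]
      split_ifs <;> simp
    rw [← hρr j' k hjj', h1]
    simp_rw [h2]
    rw [← Finset.sum_filter, Finset.sum_subtype (Finset.univ.filter fun x : Fin m => blk x = k)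
      (p := fun x : Fin m => blk x = k) (fun x => by simp)]
    refine Finset.sum_congr rfl fun x _ => ?_
    rw [hρr x.1 k x.2]
  have hu' : u = Pi.single (⟨j', hjj'⟩ : {x // blk x = k}) (1 : K) :=
    Matrix.vecMul_injective_of_isUnit hM hu
  have h3 := congrFun hu' ⟨j, hk.symm⟩
  simp only [u, Pi.single_apply, Subtype.mk.injEq] at h3
  rw [h3]
  by_cases h : j = j'
  · rw [if_pos h, if_pos h.symm]
  · rw [if_neg h, if_neg (Ne.symm h)]

end Pivot

/-! ### The eigenbasis chart of a finite-order stabilizer element -/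

section EigenChart

variable {m : ℕ} {K : Type*} [Field K] [IsAlgClosed K] [CharZero K]

/-- **Eigenbasis chart.** Let `γ` be a linear substitution of finite order (`γ^n = 1`, `n > 0`)
stabilising a form `w` of degree `D` over an algebraically closed field of characteristic `0`, and
let `c` be its tuple of eigenvalues (all nonzero). Either `γ` is the scalar `c_{i₀} · 1` (when all
eigenvalues coincide), or — in any case — `w = g · v` where `v` is a form of degree `D` supported on
the `diag(c)`-invariant monomials `invMonomials D c` and `g` is a specialisation of the pivot chart
matrix `chartMatrix K (blkOf c) ρ` for some choice of pivot rows `ρ` injective on the eigenvalue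
blocks. (Diagonalise `γ = P diag(c) P⁻¹`; `P⁻¹ · w` is `diag(c)`-invariant; factor `P = g · l` by
`exists_pivot_decomposition`; `l` commutes with `diag(c)`.)
[cite: BurgisserIkenmeyer2017, §2.1 ("almost all w ∈ Sym^D ℂ^m have a trivial stabilizer")] -/
theorem exists_eigenChart_of_pow_eq_one {D n : ℕ} {w : MvPolynomial (Fin m) K}
    (hw : w.IsHomogeneous D) {γ : Matrix (Fin m) (Fin m) K} (hn : 0 < n) (hγn : γ ^ n = 1)
    (hstab : linSubst (Fin m) K γ w = w) :
    ∃ c : Fin m → K, (∀ i, c i ≠ 0) ∧ (∀ i₀, (∀ i, c i = c i₀) → γ = c i₀ • (1 : Matrix _ _ K)) ∧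
      ∃ ρ : Fin m → Fin m, (∀ j j', blkOf c j = blkOf c j' → ρ j = ρ j' → j = j') ∧
        ∃ (p : chartVars (blkOf c) ρ → K) (v : MvPolynomial (Fin m) K),
          v.IsHomogeneous D ∧ v.support ⊆ invMonomials D c ∧
          w = linSubst (Fin m) K ((chartMatrix K (blkOf c) ρ).map (MvPolynomial.eval p)) v := by
  classical
  -- diagonalise `γ`
  obtain ⟨P, c, hP, hPc⟩ :=
    Literature.RepresentationTheory.ClassicalInvariants.LinearSubstitution.exists_mul_eq_mul_diagonal_of_pow_eq_one
      hn hγn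
  have hγdet : IsUnit γ.det :=
    IsUnit.of_pow_eq_one (by rw [← det_pow, hγn, det_one]) hn.ne'
  -- the eigenvalues are nonzero: `det γ = ∏ c_i`
  have hprod : ∏ i, c i = γ.det := by
    have h := congrArg Matrix.det hPc
    rw [det_mul, det_mul, det_diagonal, mul_comm] at h
    exact (mul_left_cancel₀ hP.ne_zero h).symm
  have hc0 : ∀ i, c i ≠ 0 := fun i hi =>
    hγdet.ne_zero (by rw [← hprod]; exact Finset.prod_eq_zero (Finset.mem_univ i) hi)
  have hPP : P * P⁻¹ = 1 := Matrix.mul_nonsing_inv P hP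
  have hP'P : P⁻¹ * P = 1 := Matrix.nonsing_inv_mul P hP
  refine ⟨c, hc0, ?_, ?_⟩
  · -- scalar case
    intro i₀ hci
    have hdiag : diagonal c = c i₀ • (1 : Matrix (Fin m) (Fin m) K) := by
      ext i j
      rw [diagonal_apply, Matrix.smul_apply, Matrix.one_apply, smul_eq_mul, mul_ite, mul_one, mul_zero]
      split_ifs with h
      · subst h; exact hci i
      · rfl
    calc γ = γ * P * P⁻¹ := by rw [Matrix.mul_assoc, hPP, Matrix.mul_one]
      _ = P * (c i₀ • (1 : Matrix (Fin m) (Fin m) K)) * P⁻¹ := by rw [hPc, hdiag]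
      _ = c i₀ • (1 : Matrix (Fin m) (Fin m) K) := by
        rw [Matrix.mul_smul, Matrix.mul_one, Matrix.smul_mul, hPP]
  · -- the chart
    -- `v₀ = P⁻¹ · w` is `diag(c)`-invariant and `w = P · v₀`
    set v₀ := linSubst (Fin m) K P⁻¹ w with hv₀
    have hv₀hom : v₀.IsHomogeneous D := linSubst_isHomogeneous _ hw
    have hconj : P⁻¹ * γ * P = diagonal c := by
      rw [Matrix.mul_assoc, hPc, ← Matrix.mul_assoc, hP'P, Matrix.one_mul]
    have hv₀inv : linSubst (Fin m) K (diagonal c) v₀ = v₀ := by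
      rw [hv₀, ← hconj, linSubst_mul, linSubst_mul, AlgHom.comp_apply, AlgHom.comp_apply,
        ← AlgHom.comp_apply (linSubst (Fin m) K P), ← linSubst_mul, hPP, linSubst_one,
        AlgHom.id_apply, hstab]
    have hwv₀ : w = linSubst (Fin m) K P v₀ := by
      rw [hv₀, ← AlgHom.comp_apply, ← linSubst_mul, hPP, linSubst_one, AlgHom.id_apply]
    -- pivot decomposition `P = g · l` for the eigenvalue blocks
    obtain ⟨ρ, hρ, l, g, hl0, -, hg, hPgl⟩ := exists_pivot_decomposition (blkOf c) P hP
    have hlc : l * diagonal c = diagonal c * l :=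
      mul_diagonal_eq_diagonal_mul_of_apply_eq_zero fun i j hij =>
        hl0 i j (mt (blkOf_eq_blkOf_iff c i j).mp hij)
    refine ⟨ρ, hρ, fun q => g q.1.1 q.1.2, linSubst (Fin m) K l v₀,
      linSubst_isHomogeneous _ hv₀hom,
      support_subset_invMonomials (linSubst_isHomogeneous _ hv₀hom)
        (linSubst_diagonal_linSubst_eq hlc hv₀inv), ?_⟩
    rw [chartMatrix_map_eval hρ hg, ← AlgHom.comp_apply, ← linSubst_mul, ← hPgl]
    exact hwv₀

end EigenChart

end Literature.Computability.AlgebraicComplexity
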